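import Literature.MathematicalPhysics.QuantumFieldTheory.Balaban1983to89.BlockAveragingEMLProp2
import Literature.MathematicalPhysics.QuantumFieldTheory.Balaban1983to89.Node00.BackgroundActionOfRecord
import Literature.MathematicalPhysics.QuantumFieldTheory.Balaban1983to89.Node00.BackgroundCurrentShape

/-!
# YM-DAG node N21 (= NE7c) — THE AVERAGED DATUM OF A REGULAR BACKGROUND IS REGULAR, AT NODE 00's AVERAGING OF RECORD:
# [Balaban1985Averaging] Prop. 2 (52) ⇒ (54) for `Node00.avOfRecord` BY NAME, and the one-call END's γ3 reading `hcore` at ₈a's minimiser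

Track A of `YM-PLAN.md` (cell `pub-ymgap`, HUMAN RULING D-0062), node **N21** = NE7c (`T4IndicatorShell.ShellWeightBound`, NOT PRINTED); seat
`pub-ymgap-dag-n21-c` (generation 2; director-ym R134 row s1 «the [B15] p. 193 template INSTANCE feeding the one-call END's live-factor hypotheses», successor
item S4 of the g0 HANDOFF).  THEOREMS ONLY (0 `def`, 0 `sorry`); COUNT-NEUTRAL; `--supports stmt-QuantumFields-19676` (K3 `SpineGivenEndpointR11`).  Imports the
seat's `BlockAveragingEMLProp2` (p469485 — [Balaban1985Averaging] Props. 1–2 for the (0.4) averaging, PROVED), ₈a `Node00.BackgroundActionOfRecord` and n01-b's `Node00.BackgroundCurrentShape`;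
nothing there is modified.

WHAT IS AT STAKE.  The one call of record for NE7c, `ShellMeasureLiveEndOneCallUnionLevelsCfLinJunction.shellWeightBound_live_oneCall_union_levels_cfB7_lin_junction`
(p241094), displays the γ3 WINDOW READINGS `hcore ∕ hcollar` (crew census `ONECALL-CENSUS-NE7c.md` §13): «if the slot variable — the block-sup of
`|U_k(V)(∂p) − 1|` for the background `U_k(V)` of the datum `V` — is below `εη_k²`, then `V` is `a`-plaquette-small on the box».  With `Ū^k(U_k(V)) = V`
([Balaban1987RG1] (0.21)) this is exactly [Balaban1985Averaging] Proposition 2 (52) ⇒ (54) for the AVERAGING OF RECORD `Node00.avOfRecord F N K j =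
BlockAveraging.blockAvg ExpMeanLog.expMeanLogSU` — which the tree now has (`BlockAveragingEMLProp2.plaqSmall_iter_blockAvg_eml_eta`, uniform in `k`; before
p469485 only the crude, `k`-exponential one-step bound `BlockAveragingPlaquetteBound` existed for (0.4)).

CONTENT (all at the `K`-th torus of a four-torus family `F`, group `SU(N)`; `C₀(d) = 143·((d+4)²/4)²`, `c′₂ = 2δ_N/((d+4)L)²`, `δ_N = min(1/3, π/N)`).
* §1 `plaqSmall_iter_avOfRecord` — (52) ⇒ (54) AT THE AVERAGING OF RECORD: `PlaqSmall (α₀η_k²) U ⇒ PlaqSmall (2α₀) (Averaging.iter (avOfRecord F N K) k U)`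
  for `0 < α₀`, `C₀α₀ ≤ ⅓`, `2α₀ ≤ c′₂`; `plaqSmall_iter_avOfRecord_sharp` (the `α₀ + 2C₀α₀²` form).
* §2 THE `hcore` DIRECTION AT ₈a's MINIMISER OF RECORD `Node00.Uk`: `plaqSmall_datum_of_isBackground` (ANY minimiser over `bgReg(ε)` with `Ū^k = V` forces
  `PlaqSmall (2ε) V`), **`plaqSmall_datum_of_ukExists`** (the (0.21) problem within `bgReg(ε)` is SOLVABLE ONLY AT `2ε`-REGULAR DATA), **`plaqSmall_datum_of_Uk_plaqSmall`**
  (the γ3 reading in its global form: `U_k(V)` `θη_k²`-plaquette-small ⇒ `V` `2θ`-plaquette-small, any admissible `θ`), `plaqSmall_datum_of_inUkClassB11`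
  (the same from [Balaban1985Variational] (2)'s class, `InUkClassB11 ⊆ bgReg`).
* §3 non-vacuity: `smallness_inhabited` (the three numeric side conditions are jointly satisfiable and (52) holds at the flat configuration).

HONEST FRAMING.  Kernel bookkeeping: §1 is the seat's Literature theorem read at `avOfRecord` (definitionally `fun _ => blockAvg expMeanLogSU`), §2 composes it
with ₈a's `iter_Uk ∕ Uk_mem_bgReg`.  The END's `hcore` is a BOX-LOCALISED reading; the global form here is its species at the record, not a discharge of the one
call's binder (whose objects are node O's).  Nothing of NE7c ∕ (M1) is touched; N21 NOT discharged; counts 5∕27 unmoved; one finite four-torus programme at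
fixed `ε` — NOT continuum ∕ ℝ⁴ ∕ OS ∕ mass gap ∕ Clay.  No `def`, no `instance`, no `notation`.
-/

noncomputable section

namespace Summit.QuantumFields.YangMills.Theorems.N21AveragedDatumRegularity

open Literature.MathematicalPhysics.QuantumFieldTheory.Balaban1983to89
open Literature.MathematicalPhysics.QuantumFieldTheory.Balaban1983to89.T4Continuum (T4Family)
open Literature.MathematicalPhysics.QuantumFieldTheory.Balaban1983to89.Node00
open Literature.MathematicalPhysics.QuantumFieldTheory.Balaban1983to89.BlockAveraging (blockAvg)
open Literature.MathematicalPhysics.QuantumFieldTheory.Balaban1983to89.ExpMeanLog (expMeanLogSU deltaSU)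
open Literature.MathematicalPhysics.QuantumFieldTheory.Balaban1983to89.BlockAveragingEMLProp2

variable {F : T4Family} {N : ℕ} [NeZero N]

/-! ## §1 (52) ⇒ (54) at the averaging of record -/

/-- **[Balaban1985Averaging] PROP. 2 AT NODE 00's AVERAGING OF RECORD**: if every plaquette variable of `U` on the finest torus of the `K`-th
approximation is within `α₀η_k²` of `1` (`η_k = L^{−k}`), `0 < α₀`, `C₀(d)α₀ ≤ ⅓`, `2α₀ ≤ c′₂`, then every plaquette variable of the `k`-fold average
of record `Ū^k = Averaging.iter (avOfRecord F N K) k U` is within `2α₀` of `1`. [cite: Balaban1985Averaging, Prop. 2 (52)–(54) p.26] -/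
theorem plaqSmall_iter_avOfRecord (K k : ℕ) {α₀ : ℝ} (hα : 0 < α₀)
    (hα3 : (143 * (((((F.P K).d + 4 : ℕ) : ℝ)) ^ 2 / 4) ^ 2) * α₀ ≤ 1 / 3)
    (hα2 : 2 * α₀ ≤ 2 * deltaSU (Fin N) / ((((F.P K).d + 4) * (F.P K).L : ℕ) : ℝ) ^ 2)
    {U : GaugeField (F.P K) 0 (SU N)} (h52 : PlaqSmall (α₀ * (F.P K).eta k ^ 2) U) :
    PlaqSmall (2 * α₀) (Averaging.iter (avOfRecord F N K) k U) :=
  plaqSmall_iter_blockAvg_eml_eta k hα hα3 hα2 h52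

/-- The sharp (54) form at the averaging of record: `PlaqSmall (α₀ + 2C₀α₀²) Ū^k`. [cite: Balaban1985Averaging, Prop. 2 (54) p.26] -/
theorem plaqSmall_iter_avOfRecord_sharp (K k : ℕ) {α₀ : ℝ} (hα : 0 < α₀)
    (hα3 : (143 * (((((F.P K).d + 4 : ℕ) : ℝ)) ^ 2 / 4) ^ 2) * α₀ ≤ 1 / 3)
    (hα2 : 2 * α₀ ≤ 2 * deltaSU (Fin N) / ((((F.P K).d + 4) * (F.P K).L : ℕ) : ℝ) ^ 2)
    {U : GaugeField (F.P K) 0 (SU N)} (h52 : PlaqSmall (α₀ * (F.P K).eta k ^ 2) U) :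
    PlaqSmall (α₀ + 2 * (143 * (((((F.P K).d + 4 : ℕ) : ℝ)) ^ 2 / 4) ^ 2) * α₀ ^ 2) (Averaging.iter (avOfRecord F N K) k U) := by
  have h52' : PlaqSmall (α₀ * ((((F.P K).L : ℝ) ^ k)⁻¹) ^ 2) U := by
    intro p; have := h52 p; rwa [Params.eta, inv_pow] at this
  exact plaqSmall_iter_blockAvg_eml k hα hα3 hα2 h52'

/-! ## §2 The γ3 reading `hcore` at ₈a's minimiser of record: regular background ⇒ regular datum -/

/-- **ANY MINIMISER OF (0.21) WITHIN `bgReg(ε)` HAS A `2ε`-REGULAR DATUM**: if `U₀` minimises over `bgReg F N K k ε` with `Ū₀^k = V` (`Setup.IsBackground` along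
`avOfRecord`) and `ε` is admissible (`0 < ε`, `C₀ε ≤ ⅓`, `2ε ≤ c′₂`), then `|V(∂p) − 1| < 2ε` for every plaquette of `T^{(k)}` — (52) for `U₀` is its
membership in `bgReg(ε)` (`|U₀(∂p) − 1| < εη_k²`), (54) is read at `V = Ū₀^k`. [cite: Balaban1985Averaging, Prop. 2 (52)–(54) p.26] -/
theorem plaqSmall_datum_of_isBackground (K k : ℕ) {ε : ℝ} (hε : 0 < ε)
    (hε3 : (143 * (((((F.P K).d + 4 : ℕ) : ℝ)) ^ 2 / 4) ^ 2) * ε ≤ 1 / 3)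
    (hε2 : 2 * ε ≤ 2 * deltaSU (Fin N) / ((((F.P K).d + 4) * (F.P K).L : ℕ) : ℝ) ^ 2)
    {V : GaugeField (F.P K) k (SU N)} {U₀ : GaugeField (F.P K) 0 (SU N)}
    (hU₀ : IsBackground (avOfRecord F N K) (bgReg F N K k ε) k V U₀) : PlaqSmall (2 * ε) V := by
  have h52 : PlaqSmall (ε * (F.P K).eta k ^ 2) U₀ := (mem_bgReg_iff F N K k ε U₀).1 hU₀.2.1
  rw [← hU₀.1]
  exact plaqSmall_iter_avOfRecord K k hε hε3 hε2 h52

/-- **THE (0.21) PROBLEM WITHIN `bgReg(ε)` IS SOLVABLE ONLY AT `2ε`-REGULAR DATA**: `UkExists F N K k ε V ⇒ PlaqSmall (2ε) V` (admissible `ε`).  Consequence for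
every consumer of ₈a: on the solvable set the datum's plaquettes are automatically small, with NO separate regularity hypothesis on `V`.
[cite: Balaban1985Averaging, Prop. 2 (52)–(54) p.26] -/
theorem plaqSmall_datum_of_ukExists (K k : ℕ) {ε : ℝ} (hε : 0 < ε)
    (hε3 : (143 * (((((F.P K).d + 4 : ℕ) : ℝ)) ^ 2 / 4) ^ 2) * ε ≤ 1 / 3)
    (hε2 : 2 * ε ≤ 2 * deltaSU (Fin N) / ((((F.P K).d + 4) * (F.P K).L : ℕ) : ℝ) ^ 2)
    {V : GaugeField (F.P K) k (SU N)} (h : UkExists F N K k ε V) : PlaqSmall (2 * ε) V :=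
  plaqSmall_datum_of_isBackground K k hε hε3 hε2 (isBackground_Uk h)

/-- **THE γ3 READING `hcore` OF THE ONE-CALL END AT ₈a's MINIMISER, GLOBAL FORM**: on the solvable set, if the background of record `U_k(V) = Node00.Uk F N K k ε V`
is `θη_k²`-plaquette-small for an admissible `θ` (e.g. the slot's LOWERED threshold), then the datum `V` is `2θ`-plaquette-small — «slot variable `< θη_k²` ⇒ datum
`2θ`-small» with `Ū^k(U_k(V)) = V` (`Node00.iter_Uk`). [cite: Balaban1985Averaging, Prop. 2 (52)–(54) p.26] -/
theorem plaqSmall_datum_of_Uk_plaqSmall (K k : ℕ) {ε θ : ℝ} (hθ : 0 < θ)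
    (hθ3 : (143 * (((((F.P K).d + 4 : ℕ) : ℝ)) ^ 2 / 4) ^ 2) * θ ≤ 1 / 3)
    (hθ2 : 2 * θ ≤ 2 * deltaSU (Fin N) / ((((F.P K).d + 4) * (F.P K).L : ℕ) : ℝ) ^ 2)
    {V : GaugeField (F.P K) k (SU N)} (h : UkExists F N K k ε V) (hu : PlaqSmall (θ * (F.P K).eta k ^ 2) (Uk F N K k ε V)) :
    PlaqSmall (2 * θ) V := by
  rw [← iter_Uk h]
  exact plaqSmall_iter_avOfRecord K k hθ hθ3 hθ2 hu

/-- The same from [Balaban1985Variational] (2)'s class at the record (`Node00.InUkClassB11 ⊆ bgReg`, n01-b's `InUkClassB11.mem_bgReg`): a minimiser over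
`{U | InUkClassB11 F N K k e U}` with `Ū^k = V` has a `2e`-regular datum — the direction converse to [Balaban1985Variational] Thm 1 (7) ⇒ (8) at NODE 00's objects.
[cite: Balaban1985Averaging, Prop. 2 (52)–(54) p.26] -/
theorem plaqSmall_datum_of_inUkClassB11 (K k : ℕ) {e : ℝ} (he : 0 < e)
    (he3 : (143 * (((((F.P K).d + 4 : ℕ) : ℝ)) ^ 2 / 4) ^ 2) * e ≤ 1 / 3)
    (he2 : 2 * e ≤ 2 * deltaSU (Fin N) / ((((F.P K).d + 4) * (F.P K).L : ℕ) : ℝ) ^ 2)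
    {V : GaugeField (F.P K) k (SU N)} {U₀ : GaugeField (F.P K) 0 (SU N)}
    (hU₀ : IsBackground (avOfRecord F N K) {U | InUkClassB11 F N K k e U} k V U₀) : PlaqSmall (2 * e) V := by
  have h52 : PlaqSmall (e * (F.P K).eta k ^ 2) U₀ := (mem_bgReg_iff F N K k e U₀).1 (InUkClassB11.mem_bgReg hU₀.2.1)
  rw [← hU₀.1]
  exact plaqSmall_iter_avOfRecord K k he he3 he2 h52

/-! ## §3 Non-vacuity of the numeric side conditions -/

/-- **THE SIDE CONDITIONS ARE JOINTLY SATISFIABLE AND (52) HOLDS AT THE FLAT CONFIGURATION**: for `α₀ = min{1/(3C₀), c′₂/2} > 0` all three numeric hypotheses of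
§1 hold and `U ≡ 1` satisfies (52) at every level; so §1–§2 are not vacuous. [cite: Balaban1985Averaging, Prop. 2 p.26 («α₀ ≦ c₂ = min{1/(3C₀), ½c′₂}»)] -/
theorem smallness_inhabited (K k : ℕ) : ∃ α₀ : ℝ, 0 < α₀ ∧
    (143 * (((((F.P K).d + 4 : ℕ) : ℝ)) ^ 2 / 4) ^ 2) * α₀ ≤ 1 / 3 ∧
    2 * α₀ ≤ 2 * deltaSU (Fin N) / ((((F.P K).d + 4) * (F.P K).L : ℕ) : ℝ) ^ 2 ∧
    PlaqSmall (α₀ * (F.P K).eta k ^ 2) (1 : GaugeField (F.P K) 0 (SU N)) := by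
  set C₀ : ℝ := 143 * (((((F.P K).d + 4 : ℕ) : ℝ)) ^ 2 / 4) ^ 2 with hC₀
  set c₂ : ℝ := 2 * deltaSU (Fin N) / ((((F.P K).d + 4) * (F.P K).L : ℕ) : ℝ) ^ 2 with hc₂
  have hC₀pos : 0 < C₀ := by positivity
  have hc₂pos : 0 < c₂ := by
    have := (F.P K).L_pos
    have hδ : 0 < deltaSU (Fin N) := ExpMeanLog.deltaSU_pos
    positivity
  refine ⟨min (1 / (3 * C₀)) (c₂ / 2), lt_min (by positivity) (by positivity), ?_, ?_, fun p => ?_⟩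
  · calc C₀ * min (1 / (3 * C₀)) (c₂ / 2) ≤ C₀ * (1 / (3 * C₀)) := mul_le_mul_of_nonneg_left (min_le_left _ _) hC₀pos.le
      _ = 1 / 3 := by field_simp
  · linarith [min_le_right (1 / (3 * C₀)) (c₂ / 2)]
  · have h1 : GaugeField.plaqHol (1 : GaugeField (F.P K) 0 (SU N)) p = 1 := by
      simp [GaugeField.plaqHol, show ∀ b, (1 : GaugeField (F.P K) 0 (SU N)) b = 1 from fun _ => rfl]
    rw [h1, GaugeGroup.dist1_one]
    have hη : 0 < (F.P K).eta k := pow_pos (inv_pos.mpr (Nat.cast_pos.mpr (F.P K).L_pos)) k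
    exact mul_pos (lt_min (by positivity) (by positivity)) (pow_pos hη 2)

end Summit.QuantumFields.YangMills.Theorems.N21AveragedDatumRegularity

end

namespace Summit.QuantumFields.YangMills.Theorems.N21AveragedDatumRegularity

open Literature.MathematicalPhysics.QuantumFieldTheory.Balaban1983to89
open Literature.MathematicalPhysics.QuantumFieldTheory.Balaban1983to89.T4Continuum (T4Family)
open Literature.MathematicalPhysics.QuantumFieldTheory.Balaban1983to89.Node00
open Literature.MathematicalPhysics.QuantumFieldTheory.Balaban1983to89.BlockAveraging (blockAvg)
open Literature.MathematicalPhysics.QuantumFieldTheory.Balaban1983to89.ExpMeanLog (expMeanLogSU deltaSU)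
open Literature.MathematicalPhysics.QuantumFieldTheory.Balaban1983to89.BlockAveragingEMLProp2

variable {F : T4Family} {N : ℕ} [NeZero N]

/-! ## §4 (v1.1, append-only) ALL INTERMEDIATE AVERAGES of a regular background — the (53) levels at the record: the data `Ū^j(U)`, `j ≤ k`,
of a `α₀η_k²`-regular `U` are `2α₀(L^jη_k)²`-regular; at ₈a's minimiser this is the regularity of every intermediate datum `Ū^j(U_k(V))` that the
composition-of-minimisers bookkeeping ([Balaban1987RG1] (0.23); [Balaban1985UV3] (44) «regularity of U_k ⇒ regularity of all the averages Ū_k^j») reads -/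

/-- **(53) AT THE AVERAGING OF RECORD, EVERY LEVEL `j ≤ k`**: `PlaqSmall (α₀η_k²) U ⇒ PlaqSmall (2α₀(L^jη_k)²) (Averaging.iter (avOfRecord F N K) j U)`
(`0 < α₀`, `C₀(d)α₀ ≤ ⅓`, `2α₀ ≤ c′₂`). [cite: Balaban1985Averaging, (53) p.26] -/
theorem plaqSmall_iter_avOfRecord_level (K k : ℕ) {α₀ : ℝ} (hα : 0 < α₀)
    (hα3 : (143 * (((((F.P K).d + 4 : ℕ) : ℝ)) ^ 2 / 4) ^ 2) * α₀ ≤ 1 / 3)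
    (hα2 : 2 * α₀ ≤ 2 * deltaSU (Fin N) / ((((F.P K).d + 4) * (F.P K).L : ℕ) : ℝ) ^ 2)
    {U : GaugeField (F.P K) 0 (SU N)} (h52 : PlaqSmall (α₀ * (F.P K).eta k ^ 2) U) {j : ℕ} (hj : j ≤ k) :
    PlaqSmall (2 * α₀ * (((F.P K).L : ℝ) ^ j * (F.P K).eta k) ^ 2) (Averaging.iter (avOfRecord F N K) j U) := by
  have h52' : PlaqSmall (α₀ * ((((F.P K).L : ℝ) ^ k)⁻¹) ^ 2) U := by
    intro p; have := h52 p; rwa [Params.eta, inv_pow] at this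
  have h := plaqSmall_iter_blockAvg_eml_level (n := Fin N) k hα hα3 hα2 h52' hj
  intro p
  have hp := h p
  rwa [Params.eta, inv_pow]

/-- **EVERY INTERMEDIATE DATUM OF ₈a's MINIMISER IS REGULAR**: on the solvable set, `Ū^j(U_k(V))` is `2ε(L^jη_k)²`-plaquette-small for every `j ≤ k`
(`U_k(V) ∈ bgReg(ε)` is (52); [Balaban1985UV3] p. 267 «regularity of U_k ⇒ regularity of all the averages Ū_k^j» at NODE 00's averaging).
[cite: Balaban1985Averaging, (53) p.26] -/
theorem plaqSmall_iter_Uk_level (K k : ℕ) {ε : ℝ} (hε : 0 < ε)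
    (hε3 : (143 * (((((F.P K).d + 4 : ℕ) : ℝ)) ^ 2 / 4) ^ 2) * ε ≤ 1 / 3)
    (hε2 : 2 * ε ≤ 2 * deltaSU (Fin N) / ((((F.P K).d + 4) * (F.P K).L : ℕ) : ℝ) ^ 2)
    {V : GaugeField (F.P K) k (SU N)} (h : UkExists F N K k ε V) {j : ℕ} (hj : j ≤ k) :
    PlaqSmall (2 * ε * (((F.P K).L : ℝ) ^ j * (F.P K).eta k) ^ 2) (Averaging.iter (avOfRecord F N K) j (Uk F N K k ε V)) :=
  plaqSmall_iter_avOfRecord_level K k hε hε3 hε2 ((mem_bgReg_iff F N K k ε _).1 (Uk_mem_bgReg h)) hj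

/-- The top level `j = k` of §4 is §2 again (`L^kη_k = 1`): a consistency check of the two routes. [cite: Balaban1985Averaging, (54) p.26] -/
theorem plaqSmall_datum_of_ukExists' (K k : ℕ) {ε : ℝ} (hε : 0 < ε)
    (hε3 : (143 * (((((F.P K).d + 4 : ℕ) : ℝ)) ^ 2 / 4) ^ 2) * ε ≤ 1 / 3)
    (hε2 : 2 * ε ≤ 2 * deltaSU (Fin N) / ((((F.P K).d + 4) * (F.P K).L : ℕ) : ℝ) ^ 2)
    {V : GaugeField (F.P K) k (SU N)} (h : UkExists F N K k ε V) : PlaqSmall (2 * ε) V := by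
  have hL : ((F.P K).L : ℝ) ^ k * (F.P K).eta k = 1 := by
    rw [Params.eta, inv_pow]
    exact mul_inv_cancel₀ (pow_ne_zero _ (Nat.cast_ne_zero.mpr (ne_of_gt (F.P K).L_pos)))
  have hk := plaqSmall_iter_Uk_level K k hε hε3 hε2 h le_rfl
  rw [iter_Uk h, hL, one_pow, mul_one] at hk
  exact hk

end Summit.QuantumFields.YangMills.Theorems.N21AveragedDatumRegularity
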